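import Summits.CriticalPhenomena.SAWScalingLimit.Theorems.SAWBrickWallHomotopyModulusUniversalityNotTightExtraction
import Summits.CriticalPhenomena.SAWScalingLimit.Theorems.SubseqIdentification.Negative.ProbabilityRedundant
import Literature.Probability.RandomPlanarGeometry.DiagonalDressedSAW
import Literature.Probability.RandomPlanarGeometry.HexParafermionSpinShift
import Literature.Probability.Percolation.QuadCrossingCrossedEventInterior
import HarnessLib

/-!
# `ModulusUniversality`, line `birth`: stub N₂ — the crux implies tightness of the `ℤ²` SAW laws

Helper file (`--supports stmt-CriticalPhenomena-5790`) of the line `birth` / `registered` for the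
crux `SAWBrickWallHomotopy.ModulusUniversality` (skeleton
`Summits/CriticalPhenomena/SAWScalingLimit/Cruxes/ModulusUniversality/Lines/birth.lean`), wave 2:
the registered sub-goal `z2Tight_of_modulusUniversality`, NECESSITY of tightness —

  `ModulusUniversality → ∀ D a b, IsEndpointApprox D a b → IsTightAlongMesh curve (SAW.law D · (a ·) (b ·))`

(the conclusion is verbatim the crux `SAWConfRestriction.EventualTight`, stmt-CriticalPhenomena-1881).
`C_b`-merging of MUTUALLY SINGULAR finitely supported laws on the Polish space `CurveClass ℂ` forces
tightness — the phenomenon of A. D'Aristotile, P. Diaconis, D. Freedman, *On merging of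
probabilities*, Sankhyā A 50 (1988): if the `ℤ²` curve laws `μ_δ` were not tight along the mesh,
stub N₁ (`frequently_thickening_compl_of_not_isTightAlongMesh`, file
`SAWBrickWallHomotopyModulusUniversalityNotTightExtraction.lean`) drives a recursion
(`exists_mesh_recursion`) choosing meshes `δ_j ↓ 0` and finite pieces `E_j ⊆ supp μ_{δ_j}` of mass
`> ε`, pairwise `η`-separated, whose union `F₁` is closed (`isClosed_iUnion_of_separated`); the
supports of the `Φ`-images `ν_{δ_j}` of the hexagonal laws never meet `F₁` (`map_curve_ne_curve`;
at least two honeycomb steps by `eventually_ne_and_not_adj`) and accumulate only at classes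
starting at `D.pt 0 ∉ D` (sources are `1`-Lipschitz), so `F₀ = closure ⋃_j supp ν_{δ_j}` is disjoint
from `F₁`; a Urysohn function separating them has merging defect `≥ ε` along `δ_j → 0⁺`,
contradicting the crux.  Negative knowledge for the planner: no `C_b`-merging crux of this route can
land before `EventualTight`-grade tightness of the critical `ℤ²` SAW.  All [folklore].
-/

noncomputable section

open MeasureTheory Filter Topology
open scoped ENNReal NNReal
open Literature.Probability.LatticeModels
open Literature.Probability.RandomPlanarGeometry

namespace Summit.CriticalPhenomena.SAWScalingLimit.Cruxes.ModulusUniversality.Birth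

open Summit.CriticalPhenomena.SAWScalingLimit.Theorems.SubseqIdentification.Negative
  (eventually_isProbabilityMeasure_law mem_meshVertices_of_mem_support_zd)
open Summit.CriticalPhenomena.SAWScalingLimit.Theorems.ObservableToSLE.Negative
  (finite_hexDomainSAW measureReal_preimage_le_integral)
open Summit.CriticalPhenomena.SAWScalingLimit.Theorems.IsingBoundaryRatio.Negative (eventually_ne)

/-! ### Separated pieces, the mesh recursion, and the necessity theorem (registered stub N₂) -/

/-- A union of finite sets that are pairwise at distance `≥ η > 0` is closed. [folklore] -/
-- adapted from work/stubs/stub_conventionRobustness_necessity.lean (wave-1 worker)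
theorem isClosed_iUnion_of_separated {X : Type*} [MetricSpace X] {E : ℕ → Set X}
    (hE : ∀ j, (E j).Finite) {η : ℝ} (hη : 0 < η)
    (hsep : ∀ i j, i ≠ j → ∀ x ∈ E i, ∀ y ∈ E j, η ≤ dist x y) :
    IsClosed (⋃ j, E j) := by
  refine isClosed_of_closure_subset fun x hx => ?_
  rw [Metric.mem_closure_iff] at hx
  obtain ⟨y₀, hy₀, hxy₀⟩ := hx (η / 2) (half_pos hη)
  obtain ⟨i, hy₀i⟩ := Set.mem_iUnion.1 hy₀
  have hxi : x ∈ closure (E i) := by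
    rw [Metric.mem_closure_iff]
    intro r hr
    obtain ⟨y, hy, hxy⟩ := hx (min r (η / 2)) (lt_min hr (half_pos hη))
    obtain ⟨j, hyj⟩ := Set.mem_iUnion.1 hy
    by_cases hji : j = i
    · subst hji
      exact ⟨y, hyj, hxy.trans_le (min_le_left _ _)⟩
    · exfalso
      have h1 := hsep j i hji y hyj y₀ hy₀i
      have h2 : dist y y₀ < η := by
        calc dist y y₀ ≤ dist y x + dist x y₀ := dist_triangle _ _ _
          _ < η / 2 + η / 2 := by
              refine add_lt_add ?_ hxy₀
              rw [dist_comm]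
              exact hxy.trans_le (min_le_right _ _)
          _ = η := add_halves η
      exact absurd h2 (not_lt.2 h1)
  rw [(hE i).isClosed.closure_eq] at hxi
  exact Set.mem_iUnion.2 ⟨i, hxi⟩

/-- Along a honeycomb endpoint approximation the two endpoints are eventually neither equal nor
adjacent — their rescaled centres converge to the distinct marked points while equal or adjacent
vertices are `≤ δ` apart — so every SAW between them has at least two steps. [folklore] -/
theorem eventually_ne_and_not_adj {E : DobrushinDomain} {a' b' : ℝ → HexVertex}
    (hab' : SAW.IsEmbEndpointApprox hexGraph hexCenter E a' b') :
    ∀ᶠ δ in 𝓝[>] (0 : ℝ), a' δ ≠ b' δ ∧ ¬ hexGraph.Adj (a' δ) (b' δ) := by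
  have hne : E.pt 0 ≠ E.pt 1 := fun h => absurd (E.pt_injective h) (by decide)
  have h3 : 0 < dist (E.pt 0) (E.pt 1) / 3 := div_pos (dist_pos.2 hne) (by norm_num)
  filter_upwards [hab'.tendsto_fst (Metric.ball_mem_nhds _ h3),
    hab'.tendsto_snd (Metric.ball_mem_nhds _ h3), nhdsWithin_le_nhds (eventually_lt_nhds h3),
    self_mem_nhdsWithin] with δ h0 h1 hδ3 hδpos
  have hδ0 : (0 : ℝ) < δ := hδpos
  rw [Set.mem_preimage, Metric.mem_ball] at h0 h1
  have hfar : δ < dist ((δ : ℂ) * hexCenter (a' δ)) ((δ : ℂ) * hexCenter (b' δ)) := by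
    have := dist_triangle4 (E.pt 0) ((δ : ℂ) * hexCenter (a' δ)) ((δ : ℂ) * hexCenter (b' δ))
      (E.pt 1)
    rw [dist_comm] at h0
    linarith
  have hscale : dist ((δ : ℂ) * hexCenter (a' δ)) ((δ : ℂ) * hexCenter (b' δ)) =
      δ * dist (hexCenter (a' δ)) (hexCenter (b' δ)) := by
    rw [dist_eq_norm, ← mul_sub, norm_mul, Complex.norm_real, Real.norm_of_nonneg hδ0.le,
      dist_eq_norm]
  rw [hscale] at hfar
  constructor
  · intro h
    rw [h, dist_self, mul_zero] at hfar
    exact lt_irrefl _ (hfar.trans hδ0)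
  · intro h
    have h1' : dist (hexCenter (a' δ)) (hexCenter (b' δ)) ≤ 1 := by
      rw [dist_comm, dist_eq_norm, SAW.norm_hexCenter_sub_of_adj h]
      exact inv_le_one_of_one_le₀ (Real.one_le_sqrt.2 (by norm_num))
    have : δ * dist (hexCenter (a' δ)) (hexCenter (b' δ)) ≤ δ :=
      (mul_le_mul_of_nonneg_left h1' hδ0.le).trans_eq (mul_one δ)
    exact absurd hfar (not_lt.2 this)

/-- The selection recursion along the mesh filter: given that below every positive bound there is
a positive `good` mesh relative to any finite set, meshes `δ_j < 2^{-j}` are chosen one at a time,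
each good relative to the finite set `acc j` accumulated from the supports `supp (δ_i)`, `i < j`.
[folklore] -/
theorem exists_mesh_recursion {X : Type*} [DecidableEq X] (good : Finset X → ℝ → Prop)
    (supp : ℝ → Finset X)
    (h : ∀ (S : Finset X) (t : ℝ), 0 < t → ∃ δ, 0 < δ ∧ δ < t ∧ good S δ) :
    ∃ (ds : ℕ → ℝ) (acc : ℕ → Finset X), (∀ j, 0 < ds j) ∧ (∀ j, ds j < 2⁻¹ ^ j) ∧
      (∀ j, good (acc j) (ds j)) ∧ ∀ i j, i < j → supp (ds i) ⊆ acc j := by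
  choose! sel hpos hlt hgood using h
  let step : Finset X × ℝ → Finset X × ℝ := fun p =>
    (p.1 ∪ supp (sel p.1 p.2), sel p.1 p.2 / 2)
  let st : ℕ → Finset X × ℝ := fun j => step^[j] (∅, 1)
  have st_succ : ∀ j, st (j + 1) = step (st j) := fun j =>
    Function.iterate_succ_apply' step j _
  have st_pos : ∀ j, 0 < (st j).2 ∧ (st j).2 ≤ 2⁻¹ ^ j := by
    intro j
    induction j with
    | zero =>
      show 0 < (1 : ℝ) ∧ (1 : ℝ) ≤ 2⁻¹ ^ 0
      norm_num
    | succ j ih =>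
      rw [st_succ]
      show 0 < sel (st j).1 (st j).2 / 2 ∧ sel (st j).1 (st j).2 / 2 ≤ 2⁻¹ ^ (j + 1)
      refine ⟨half_pos (hpos _ _ ih.1), ?_⟩
      rw [pow_succ]
      have h1 := hlt (st j).1 (st j).2 ih.1
      have h2 := ih.2
      linarith
  refine ⟨fun j => sel (st j).1 (st j).2, fun j => (st j).1, fun j => hpos _ _ (st_pos j).1,
    fun j => (hlt _ _ (st_pos j).1).trans_le (st_pos j).2, fun j => hgood _ _ (st_pos j).1, ?_⟩
  intro i j hij
  show supp (sel (st i).1 (st i).2) ⊆ (st j).1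
  induction hij with
  | refl => rw [st_succ]; exact Finset.subset_union_right
  | step _ ih =>
    refine ih.trans ?_
    rw [st_succ]
    exact Finset.subset_union_left

/-- **Stub N₂ — the crux `ModulusUniversality` implies tightness of the critical `ℤ²` SAW laws**
(`IsTightAlongMesh`, verbatim the crux `SAWConfRestriction.EventualTight`, stmt-CriticalPhenomena-1881),
for every Dobrushin domain and every endpoint approximation.  `C_b`-merging of MUTUALLY SINGULAR,
finitely supported laws on the Polish space `CurveClass ℂ` forces tightness
(D'Aristotile–Diaconis–Freedman, *On merging of probabilities*, Sankhyā A 50 (1988)): if the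
`ℤ²` laws `μ_δ` were not tight, stub N₁ drives a recursion choosing meshes `δ_j ↓ 0` and finite
pieces `E_j ⊆ supp μ_{δ_j}` of mass `> ε`, pairwise `η`-separated, so `F₁ = ⋃ E_j` is closed; the
supports of the `Φ`-images `ν_{δ_j}` of the hexagonal laws accumulate only at classes starting at
`D.pt 0 ∉ D` (sources are `1`-Lipschitz) and never meet `F₁` (a `ℤ²` polyline is never a stretched
honeycomb polyline, `map_curve_ne_curve`), so `F₀ = closure ⋃ supp ν_{δ_j}` is disjoint from `F₁`;
a Urysohn function `f` (`= 1` on `F₁`, `= 0` on `F₀`) has `∫ f dμ_{δ_j} − ∫ f dν_{δ_j} ≥ ε` for all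
`j`, contradicting merging along `δ_j → 0⁺`. [folklore] -/
theorem z2Tight_of_modulusUniversality : Summit.CriticalPhenomena.SAWScalingLimit.Theses.SAWBrickWallHomotopy.ModulusUniversality → ∀ (D : DobrushinDomain) (a b : ℝ → Site 2), SAW.IsEndpointApprox D a b → IsTightAlongMesh (fun δ (γ : SAW.DomainSAW D.carrier δ (a δ) (b δ)) => γ.curve) (fun δ => SAW.law D.carrier δ (a δ) (b δ)) := by
  intro hMU D a b hab
  by_contra hnt
  obtain ⟨ε, hε, η, hη, hfreq⟩ :=
    frequently_thickening_compl_of_not_isTightAlongMesh D a b hab hnt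
  obtain ⟨r₁, r₂, hr₁, hr₂, H⟩ := hMU
  -- the modulus map `Φ = diag(r₁, r₂)` and the hexagonal endpoint approximation it provides
  set Φ : ℂ ≃ₜ ℂ := Literature.Probability.Percolation.QuadCrossing.stretchHomeomorph r₁ r₂ hr₁ hr₂
    with hΦdef
  have hΦ : ∀ z : ℂ, Φ z = ((r₁ * z.re : ℝ) : ℂ) + ((r₂ * z.im : ℝ) : ℂ) * Complex.I := fun z => by
    rw [hΦdef, Literature.Probability.Percolation.QuadCrossing.stretchHomeomorph_apply,
      Complex.mk_eq_add_mul_I]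
  obtain ⟨a', b', hab', hmerge⟩ := H Φ hΦ D a b hab
  clear H
  -- finite supports of the `ℤ²` curve laws
  have hSfin : ∀ δ : ℝ, 0 < δ →
      (Set.range fun γ : SAW.DomainSAW D.carrier δ (a δ) (b δ) => γ.curve).Finite := fun δ hδ => by
    haveI := SAW.finite_domainSAW D.isBounded hδ (a δ) (b δ)
    exact Set.finite_range _
  classical
  let supp : ℝ → Finset (CurveClass ℂ) := fun δ =>
    if h : 0 < δ then (hSfin δ h).toFinset else ∅
  have mem_supp : ∀ δ, 0 < δ → ∀ γ : SAW.DomainSAW D.carrier δ (a δ) (b δ), γ.curve ∈ supp δ := by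
    intro δ h γ
    simp only [supp, dif_pos h, Set.Finite.mem_toFinset]
    exact ⟨γ, rfl⟩
  -- good meshes: genuine laws, distinct `ℤ²` endpoints, honeycomb endpoints two steps apart
  have hG : ∀ᶠ δ in 𝓝[>] (0 : ℝ), IsProbabilityMeasure (SAW.law D.carrier δ (a δ) (b δ)) ∧
      a δ ≠ b δ ∧ (a' δ ≠ b' δ ∧ ¬ hexGraph.Adj (a' δ) (b' δ)) :=
    (eventually_isProbabilityMeasure_law hab).and
      ((eventually_ne hab).and (eventually_ne_and_not_adj hab'))
  -- the recursion, driven by stub N₁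
  obtain ⟨ds, acc, hds0, hds2, hgood, hacc⟩ := exists_mesh_recursion
    (fun (S : Finset (CurveClass ℂ)) (δ : ℝ) =>
      (IsProbabilityMeasure (SAW.law D.carrier δ (a δ) (b δ)) ∧ a δ ≠ b δ ∧
        (a' δ ≠ b' δ ∧ ¬ hexGraph.Adj (a' δ) (b' δ))) ∧
      ε < ((SAW.law D.carrier δ (a δ) (b δ)).map fun γ => γ.curve)
        (Metric.thickening η (S : Set (CurveClass ℂ)))ᶜ) supp
    (fun S t ht => by
      have hlt : ∀ᶠ δ in 𝓝[>] (0 : ℝ), δ < t := nhdsWithin_le_nhds (eventually_lt_nhds ht)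
      obtain ⟨δ, h1, ⟨h2, hδ⟩, h3⟩ :=
        ((hfreq S).and_eventually ((hG.and self_mem_nhdsWithin).and hlt)).exists
      exact ⟨δ, hδ, h3, h2, h1⟩)
  have hprob : ∀ j, IsProbabilityMeasure (SAW.law D.carrier (ds j) (a (ds j)) (b (ds j))) :=
    fun j => (hgood j).1.1
  have hab_ne : ∀ j, a (ds j) ≠ b (ds j) := fun j => (hgood j).1.2.1
  have hne' : ∀ j, a' (ds j) ≠ b' (ds j) := fun j => (hgood j).1.2.2.1
  have hnadj' : ∀ j, ¬ hexGraph.Adj (a' (ds j)) (b' (ds j)) := fun j => (hgood j).1.2.2.2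
  have heps : ∀ j, ε < ((SAW.law D.carrier (ds j) (a (ds j)) (b (ds j))).map fun γ => γ.curve)
      (Metric.thickening η (acc j : Set (CurveClass ℂ)))ᶜ := fun j => (hgood j).2
  -- the chosen meshes tend to `0⁺`
  have hds : Tendsto ds atTop (𝓝[>] (0 : ℝ)) := by
    refine tendsto_nhdsWithin_iff.2 ⟨?_, Eventually.of_forall fun j => hds0 j⟩
    exact squeeze_zero (fun j => (hds0 j).le) (fun j => (hds2 j).le)
      (tendsto_pow_atTop_nhds_zero_of_lt_one (by norm_num) (by norm_num))
  -- separated escaping pieces `E j` of `μ_{δ_j}`-mass `> ε`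
  set E : ℕ → Set (CurveClass ℂ) := fun j =>
    (Set.range fun γ : SAW.DomainSAW D.carrier (ds j) (a (ds j)) (b (ds j)) => γ.curve) \
      Metric.thickening η (acc j : Set (CurveClass ℂ)) with hEdef
  have hEfin : ∀ j, (E j).Finite := fun j => (hSfin _ (hds0 j)).subset fun x hx => hx.1
  have hEμ : ∀ j, ε < SAW.law D.carrier (ds j) (a (ds j)) (b (ds j))
      ((fun γ : SAW.DomainSAW D.carrier (ds j) (a (ds j)) (b (ds j)) => γ.curve) ⁻¹' E j) := by
    intro j
    have h := heps j
    rw [Measure.map_apply (SAW.DomainSAW.measurable_of_top _)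
      Metric.isOpen_thickening.measurableSet.compl] at h
    exact h.trans_le (measure_mono fun γ hγ => ⟨⟨γ, rfl⟩, hγ⟩)
  have hsep : ∀ i j, i ≠ j → ∀ x ∈ E i, ∀ y ∈ E j, η ≤ dist x y := by
    have h' : ∀ i j, i < j → ∀ x ∈ E i, ∀ y ∈ E j, η ≤ dist x y := by
      intro i j hij x hx y hy
      obtain ⟨γ, rfl⟩ := hx.1
      by_contra hlt
      exact hy.2 (Metric.mem_thickening_iff.2
        ⟨γ.curve, hacc i j hij (mem_supp _ (hds0 i) γ), by rw [dist_comm]; exact not_le.1 hlt⟩)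
    intro i j hij x hx y hy
    rcases lt_or_gt_of_ne hij with h | h
    · exact h' i j h x hx y hy
    · rw [dist_comm]; exact h' j i h y hy x hx
  have hF₁ : IsClosed (⋃ j, E j) := isClosed_iUnion_of_separated hEfin hη hsep
  -- supports of the `Φ`-images of the hexagonal laws along the chosen meshes
  set T : ℕ → Set (CurveClass ℂ) := fun j => Set.range fun γ :
    SAW.HexDomainSAW (D.map Φ.symm).carrier (ds j) (a' (ds j)) (b' (ds j)) =>
      CurveClass.map (Φ : C(ℂ, ℂ)) γ.curve with hTdef
  have hTfin : ∀ j, (T j).Finite := fun j => by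
    haveI := finite_hexDomainSAW (D.map Φ.symm).isBounded (hds0 j).ne' (a' (ds j)) (b' (ds j))
    exact Set.finite_range _
  have hpt : D.pt 0 ∉ D.carrier := fun h =>
    (Set.eq_empty_iff_forall_notMem.1 D.isOpen.inter_frontier_eq (D.pt 0)) ⟨h, D.pt_mem_frontier 0⟩
  have hsrc' : Tendsto (fun j => Φ ((ds j : ℂ) * hexCenter (a' (ds j)))) atTop (𝓝 (D.pt 0)) := by
    have h1 := hab'.tendsto_fst.comp hds
    rw [MarkedDomain.pt_map] at h1
    have h2 := (Φ.continuous.tendsto _).comp h1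
    rwa [Homeomorph.apply_symm_apply] at h2
  -- the two closed sets are disjoint
  have hdis : Disjoint (closure (⋃ j, T j)) (⋃ j, E j) := by
    rw [Set.disjoint_right]
    intro z hz hz0
    obtain ⟨i, hzi⟩ := Set.mem_iUnion.1 hz
    obtain ⟨γ, rfl⟩ := hzi.1
    -- a `ℤ²` class is never a stretched honeycomb class
    have hnot : ∀ j, (γ.curve : CurveClass ℂ) ∉ T j := fun j ⟨γ', h⟩ =>
      map_curve_ne_curve hΦ hr₁.ne' hr₂.ne' γ (hds0 j).ne' (hne' j) (hnadj' j) γ' h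
    -- its source lies in the open carrier, at distance `≥ ρ` from `D.pt 0`
    have hγs : γ.curve.source = meshPoint (ds i) (a (ds i)) :=
      SimpleGraph.Walk.toCurve_apply_zero _ _
    have hmem : meshPoint (ds i) (a (ds i)) ∈ D.carrier :=
      mem_meshVertices_of_mem_support_zd (hab_ne i) γ.walk (SimpleGraph.Walk.start_mem_support _)
    obtain ⟨ρ, hρ, hball⟩ := Metric.isOpen_iff.1 D.isOpen _ hmem
    have hρle : ρ ≤ dist γ.curve.source (D.pt 0) := by
      rw [hγs]
      by_contra h
      exact hpt (hball (Metric.mem_ball'.2 (not_le.1 h)))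
    obtain ⟨N, hN⟩ := Metric.tendsto_atTop.1 hsrc' (ρ / 2) (half_pos hρ)
    -- an open neighbourhood of `γ.curve` missing every `T j`
    set U : Set (CurveClass ℂ) :=
      Metric.ball γ.curve (ρ / 2) ∩ (⋃ j ∈ Finset.range N, T j)ᶜ with hUdef
    have hU : IsOpen U := Metric.isOpen_ball.inter
      (isClosed_biUnion_finset fun j _ => (hTfin j).isClosed).isOpen_compl
    have hzU : γ.curve ∈ U := ⟨Metric.mem_ball_self (half_pos hρ), fun h => by
      obtain ⟨j, -, hj⟩ := Set.mem_iUnion₂.1 h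
      exact hnot j hj⟩
    have hTU : (⋃ j, T j) ⊆ Uᶜ := by
      rintro y hy ⟨hy1, hy2⟩
      obtain ⟨j, hyj⟩ := Set.mem_iUnion.1 hy
      rcases lt_or_ge j N with hjN | hjN
      · exact hy2 (Set.mem_iUnion₂.2 ⟨j, Finset.mem_range.2 hjN, hyj⟩)
      · obtain ⟨γ', rfl⟩ := hyj
        have hys : (CurveClass.map (Φ : C(ℂ, ℂ)) γ'.curve).source =
            Φ ((ds j : ℂ) * hexCenter (a' (ds j))) := by
          rw [CurveClass.source_map]
          exact congrArg Φ (SimpleGraph.Walk.toCurve_apply_zero _ _)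
        have h1 : dist (Φ ((ds j : ℂ) * hexCenter (a' (ds j)))) (D.pt 0) < ρ / 2 := hN j hjN
        have h2 := CurveClass.lipschitzWith_source.dist_le_mul
          (CurveClass.map (Φ : C(ℂ, ℂ)) γ'.curve) γ.curve
        rw [NNReal.coe_one, one_mul, hys] at h2
        rw [Metric.mem_ball] at hy1
        linarith [dist_triangle γ.curve.source (Φ ((ds j : ℂ) * hexCenter (a' (ds j)))) (D.pt 0),
          dist_comm γ.curve.source (Φ ((ds j : ℂ) * hexCenter (a' (ds j))))]
    exact (closure_minimal hTU hU.isClosed_compl) hz0 hzU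
  -- Urysohn: `f = 0` on `F₀`, `f = 1` on `F₁`, values in `[0, 1]`
  obtain ⟨g, hg0, hg1, hg01⟩ := exists_continuous_zero_one_of_isClosed isClosed_closure hF₁ hdis
  set f : BoundedContinuousFunction (CurveClass ℂ) ℝ := BoundedContinuousFunction.mkOfBound g 1
    (fun x y => by
      rw [Real.dist_eq, abs_le]
      have hx := hg01 x
      have hy := hg01 y
      constructor <;> linarith [hx.1, hx.2, hy.1, hy.2]) with hfdef
  have hf : ∀ x, f x = g x := fun _ => rfl
  have hεtop : ε ≠ ⊤ := by
    haveI := hprob 0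
    exact ne_top_of_lt ((hEμ 0).trans_le prob_le_one)
  -- along the chosen meshes the merging defect stays `≥ ε`
  have key : ∀ j, ε.toReal ≤ (∫ γ, f γ.curve ∂(SAW.law D.carrier (ds j) (a (ds j)) (b (ds j)))) -
      ∫ γ, f (CurveClass.map (Φ : C(ℂ, ℂ)) γ.curve)
        ∂(SAW.hexSAWLaw (D.map Φ.symm).carrier (ds j) (a' (ds j)) (b' (ds j))) := by
    intro j
    haveI := hprob j
    have hν0 : ∫ γ, f (CurveClass.map (Φ : C(ℂ, ℂ)) γ.curve)
        ∂(SAW.hexSAWLaw (D.map Φ.symm).carrier (ds j) (a' (ds j)) (b' (ds j))) = 0 := by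
      refine integral_eq_zero_of_ae (Eventually.of_forall fun γ' => ?_)
      show f _ = 0
      rw [hf]
      exact hg0 (subset_closure (Set.mem_iUnion.2 ⟨j, γ', rfl⟩))
    have hμ1 : (SAW.law D.carrier (ds j) (a (ds j)) (b (ds j))).real
        ((fun γ : SAW.DomainSAW D.carrier (ds j) (a (ds j)) (b (ds j)) => γ.curve) ⁻¹' ⋃ j, E j) ≤
          ∫ γ, f γ.curve ∂(SAW.law D.carrier (ds j) (a (ds j)) (b (ds j))) :=
      measureReal_preimage_le_integral (SAW.DomainSAW.measurable_of_top _) hF₁.measurableSet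
        (fun x => (hg01 x).1) fun x hx => hg1 hx
    have hμ2 : ε.toReal ≤ (SAW.law D.carrier (ds j) (a (ds j)) (b (ds j))).real
        ((fun γ : SAW.DomainSAW D.carrier (ds j) (a (ds j)) (b (ds j)) => γ.curve) ⁻¹' ⋃ j, E j) := by
      rw [measureReal_def]
      exact ENNReal.toReal_mono (measure_ne_top _ _)
        ((hEμ j).le.trans (measure_mono (Set.preimage_mono (Set.subset_iUnion E j))))
    linarith
  have hlim := (hmerge f).comp hds
  have hle : ε.toReal ≤ 0 := ge_of_tendsto' hlim fun j => key j
  exact absurd hle (not_le.2 (ENNReal.toReal_pos hε.ne' hεtop))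

end Summit.CriticalPhenomena.SAWScalingLimit.Cruxes.ModulusUniversality.Birth

end
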